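import Literature.Analysis.FluidPDE.TorusClassicalNSContinuation
import Literature.Analysis.FluidPDE.TorusClassicalLerayHopfProofs
import Literature.Analysis.FunctionSpaces.TorusClassicalNSVStability
import Literature.Analysis.FunctionSpaces.TorusClassicalNSExhaustion
import Literature.Analysis.FunctionSpaces.TorusH1LimitBounds
import HarnessLib

/-!
# Limits of global bounded-enstrophy classical Navier–Stokes solutions on `T³` are global
# classical solutions

Analysis/FluidPDE proof file (theorems only; no definitions, no named facts): the CLOSEDNESS half of the
compactness of bounded sets of strong trajectories (Robinson–Rodrigo–Sadowski 2016, Thm 6.10 — continuous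
dependence in `V` — iterated along §8.1's restart-and-continue construction; Constantin–Foias 1988 Ch. 10).
On `T^d`, `card d = 3`, `ν > 0`, steady force `F`: let `(Uₙ, Pₙ)` be GLOBAL classical solutions of NS_ν(F)
on `[0, ∞) × T^d` with mean-zero slices and a uniform enstrophy bound `‖∇Uₙ(t)‖₂² ≤ R`, and let the data
`Uₙ(0)` converge in `H¹` to a smooth divergence-free mean-zero field `w`. Then
(`Torus.exists_global_classicalNS_of_tendsto`) there is a GLOBAL classical solution `(u, p)` of NS_ν(F)
with `u(0) = w`, mean-zero slices, and `Uₙ(t) → u(t)` in `H¹` for every `t ≥ 0`; consequently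
(`Torus.exists_global_classicalNS_of_tendsto_of_bounds`) `‖∇u(t)‖₂² ≤ R` and every uniform bound on
weighted finite sums of squared Fourier coefficients (Gevrey / Sobolev partial sums) of the `Uₙ(t)` holds
for `u(t)`.

THE ARGUMENT. `Torus.classicalNS_tendsto_h1_of_tendsto_h1_left`: on a window `[a, a + τ]`, `H¹`-convergence
at time `a` of classical solutions with enstrophy `≤ R` to a classical solution propagates to the whole
window — the `V`-stability estimate `Torus.IsClassicalNSSolutionOn.h1_sub_le_mul_of_integral_laplacian_sq_le`
(E3) with the levels `M₁ = max R (sup ‖∇u‖₂²)` and `Y = ∫ₐ^{a+τ} ‖Δu‖₂²` of the LIMIT solution on the compact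
window. `Torus.classicalNS_globalLimit_step`: a solution through `w` on `[0, b]`, `b ≥ T`, to which the `Uₙ`
converge in `H¹` at every time extends to `[0, b + T/2]` with the same property — the enstrophy of `u(s)`,
`s = b − T/2`, is `≤ R` (`Torus.gradNormSq_le_of_tendsto_gradNormSq_sub`), the forced continuation theorem
`Torus.IsClassicalNSSolutionOn.exists_forced_solution_of_gradNormSq_le` (E6, around the background `U₀` on
`[0, 1]`, life span `T = T(R)`) restarts from `u(s)`, `glue_restart` identifies and glues, and the window
lemma transports the convergence. Induction gives solutions on `[0, T + mT/2]`, all through `w`, assembled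
on `[0, ∞)` by `Torus.IsClassicalNSSolutionOn.exists_of_forall_nat`. Deliberately NOT here: the extraction
of the convergent subsequence of data (Gevrey compactness, `TorusGevreyCompactness`) and any statement about
the energy space `H` (summit-side vocabulary).

## Tree search

Reused: E6 `exists_forced_solution_of_gradNormSq_le` (`TorusClassicalNSContinuation`), E3
`h1_sub_le_mul_of_integral_laplacian_sq_le` (`TorusClassicalNSVStability`), `glue_restart`, `comp_sub_const`,
`exists_of_forall_nat` (`TorusClassicalNSExhaustion`), `gradNormSq_le_of_tendsto_gradNormSq_sub`,
`sum_mul_norm_sq_mFourierCoeff_le_of_tendsto` (`TorusH1LimitBounds`),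
`IsSmoothSpaceTimeOn.continuousOn_gradNormSq` (`TorusClassicalLerayHopfProofs`). Searched `global_limit|exists_global_classicalNS|of_tendsto_h1`: nothing.

## References

* J. C. Robinson, J. L. Rodrigo, W. Sadowski, *The Three-Dimensional Navier–Stokes Equations*, CUP 2016,
  Thm 6.8, Thm 6.10, Thm 7.5, §8.1. [RobinsonRodrigoSadowskiCUP2016]
* P. Constantin, C. Foias, *Navier–Stokes Equations*, Univ. Chicago Press 1988, Ch. 10, Thm 10.2.
  [ConstantinFoiasNSE1988]
-/

noncomputable section

open MeasureTheory Set Function Filter UnitAddTorus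
open scoped ContDiff InnerProductSpace Topology NNReal

namespace Literature.Analysis.FluidPDE

open Literature.Analysis.FunctionSpaces

variable {d : Type*} [Fintype d] [DecidableEq d]

/-! ### `H¹`-convergence propagates along a window -/

section Window

/-- **`H¹`-convergence at the initial time propagates along a window.** On `[a, a + τ] × T^d`,
`card d = 3`, `ν > 0`, let `(Uₙ, Pₙ)` and `(u, p)` be classical solutions of NS_ν with the same force and
mean-zero slices, with `‖∇Uₙ(t)‖₂² ≤ R` on the window, and suppose `Uₙ(a) → u(a)` in `H¹`
(`∫ ‖Uₙ(a) − u(a)‖² → 0`, `‖∇(Uₙ(a) − u(a))‖₂² → 0`). Then `Uₙ(t) → u(t)` in `H¹` for every `t` in the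
window: the `V`-stability estimate (`h1_sub_le_mul_of_integral_laplacian_sq_le`) with the levels
`M₁ = max R (sup_{[a,a+τ]} ‖∇u‖₂²)` and `Y = ∫ₐ^{a+τ} ‖Δu‖₂²` of the limit solution.
[cite: ConstantinFoiasNSE1988, Ch. 10 Thm. 10.2 (10.7)] -/
theorem Torus.classicalNS_tendsto_h1_of_tendsto_h1_left (hd : Fintype.card d = 3) {ν : ℝ} (hν : 0 < ν)
    {a τ R : ℝ} (hτ : 0 < τ) {f : ℝ → UnitAddTorus d → EuclideanSpace ℝ d}
    {U : ℕ → ℝ → UnitAddTorus d → EuclideanSpace ℝ d} {P : ℕ → ℝ → UnitAddTorus d → ℝ}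
    (hU : ∀ n, Torus.IsClassicalNSSolutionOn (Icc a (a + τ)) ν f (U n) (P n))
    (hUmean : ∀ n, ∀ t ∈ Icc a (a + τ), Torus.HasZeroMean (U n t))
    (hUR : ∀ n, ∀ t ∈ Icc a (a + τ), Torus.gradNormSq (U n t) ≤ R)
    {u : ℝ → UnitAddTorus d → EuclideanSpace ℝ d} {p : ℝ → UnitAddTorus d → ℝ}
    (hu : Torus.IsClassicalNSSolutionOn (Icc a (a + τ)) ν f u p)
    (humean : ∀ t ∈ Icc a (a + τ), Torus.HasZeroMean (u t))
    (h0 : Tendsto (fun n => ∫ x, ‖U n a x - u a x‖ ^ 2) atTop (𝓝 0))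
    (h1 : Tendsto (fun n => Torus.gradNormSq (fun x => U n a x - u a x)) atTop (𝓝 0)) :
    ∀ t ∈ Icc a (a + τ), Tendsto (fun n => ∫ x, ‖U n t x - u t x‖ ^ 2) atTop (𝓝 0) ∧
      Tendsto (fun n => Torus.gradNormSq (fun x => U n t x - u t x)) atTop (𝓝 0) := by
  -- the enstrophy of the limit candidate is bounded on the compact window
  have haτ : a < a + τ := by linarith
  obtain ⟨B, hB⟩ := (isCompact_Icc (a := a) (b := a + τ)).bddAbove_image
    (hu.smooth_velocity.continuousOn_gradNormSq (convex_Icc a (a + τ)) (uniqueDiffOn_Icc haτ))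
  set M₁ : ℝ := max R B
  set Y : ℝ := ∫ s in a..(a + τ), (∫ x, ‖Torus.laplacian (u s) x‖ ^ 2)
  obtain ⟨C, hC⟩ := Torus.IsClassicalNSSolutionOn.h1_sub_le_mul_of_integral_laplacian_sq_le
    (d := d) hd hν M₁ Y τ hτ
  intro t ht
  have hbound : ∀ n, (∫ x, ‖U n t x - u t x‖ ^ 2) + Torus.gradNormSq (fun y => U n t y - u t y) ≤
      C * ((∫ x, ‖U n a x - u a x‖ ^ 2) + Torus.gradNormSq (fun y => U n a y - u a y)) := fun n =>
    hC (hU n) hu (hUmean n) humean (fun s hs => (hUR n s hs).trans (le_max_left _ _))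
      (fun s hs => (mem_upperBounds.1 hB _ (mem_image_of_mem _ hs)).trans (le_max_right _ _)) le_rfl t ht
  have hlim : Tendsto (fun n => C * ((∫ x, ‖U n a x - u a x‖ ^ 2) +
      Torus.gradNormSq (fun y => U n a y - u a y))) atTop (𝓝 0) := by
    have h := (h0.add h1).const_mul C
    rwa [add_zero, mul_zero] at h
  have hL0 : ∀ n, 0 ≤ ∫ x, ‖U n t x - u t x‖ ^ 2 := fun n => integral_nonneg fun x => sq_nonneg _
  have hG0 : ∀ n, 0 ≤ Torus.gradNormSq (fun y => U n t y - u t y) := fun n => Torus.gradNormSq_nonneg _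
  exact ⟨squeeze_zero hL0 (fun n => (le_add_of_nonneg_right (hG0 n)).trans (hbound n)) hlim,
    squeeze_zero hG0 (fun n => (le_add_of_nonneg_left (hL0 n)).trans (hbound n)) hlim⟩

end Window

/-! ### The restart step and the global limit solution -/

section GlobalLimit

variable {ν R T : ℝ} {F : UnitAddTorus d → EuclideanSpace ℝ d}
  {U : ℕ → ℝ → UnitAddTorus d → EuclideanSpace ℝ d} {P : ℕ → ℝ → UnitAddTorus d → ℝ}
  {w : UnitAddTorus d → EuclideanSpace ℝ d}

/-- **The restart step of the global limit.** Let `(Uₙ, Pₙ)` be global classical solutions of NS_ν(F)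
(`card d = 3`, `ν > 0`, steady `F`) with mean-zero slices and `‖∇Uₙ(t)‖₂² ≤ R`, and suppose every smooth
divergence-free mean-zero datum of enstrophy `≤ R` launches a classical solution of NS_ν(F) with mean-zero
slices on `[0, T]` (the forced continuation theorem E6). If `(u, p)` is classical on `[0, b]`, `b ≥ T`, with
mean-zero slices and `Uₙ(t) → u(t)` in `H¹` for every `t ∈ [0, b]`, then there is a classical `(u', p')`
on `[0, b + T/2]` with `u'(0) = u(0)`, mean-zero slices and `Uₙ(t) → u'(t)` in `H¹` for every
`t ∈ [0, b + T/2]`: restart at `s = b − T/2` (where `‖∇u(s)‖₂² ≤ R` by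
`gradNormSq_le_of_tendsto_gradNormSq_sub`), translate the new piece to `[s, s + T]`, identify and glue
(`glue_restart`), and transport the convergence along `[s, s + T]`
(`Torus.classicalNS_tendsto_h1_of_tendsto_h1_left`). [cite: RobinsonRodrigoSadowskiCUP2016, §8.1 with Thm 6.10] -/
theorem Torus.classicalNS_globalLimit_step (hd : Fintype.card d = 3) (hν : 0 < ν) (hT : 0 < T)
    (hU : ∀ n, Torus.IsClassicalNSSolutionOn (Ici 0) ν (fun _ => F) (U n) (P n))
    (hUmean : ∀ n, ∀ t : ℝ, 0 ≤ t → Torus.HasZeroMean (U n t))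
    (hUR : ∀ n, ∀ t : ℝ, 0 ≤ t → Torus.gradNormSq (U n t) ≤ R)
    (hE6 : ∀ u₀ : UnitAddTorus d → EuclideanSpace ℝ d, Torus.IsSmooth u₀ → Torus.IsDivFree u₀ →
      Torus.HasZeroMean u₀ → Torus.gradNormSq u₀ ≤ R →
      ∃ (v : ℝ → UnitAddTorus d → EuclideanSpace ℝ d) (q : ℝ → UnitAddTorus d → ℝ),
        Torus.IsClassicalNSSolutionOn (Icc 0 T) ν (fun _ => F) v q ∧ v 0 = u₀ ∧
          ∀ t ∈ Icc 0 T, Torus.HasZeroMean (v t))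
    {b : ℝ} (hTb : T ≤ b) {u : ℝ → UnitAddTorus d → EuclideanSpace ℝ d} {p : ℝ → UnitAddTorus d → ℝ}
    (hu : Torus.IsClassicalNSSolutionOn (Icc 0 b) ν (fun _ => F) u p)
    (humean : ∀ t ∈ Icc 0 b, Torus.HasZeroMean (u t))
    (hconv : ∀ t ∈ Icc 0 b, Tendsto (fun n => ∫ x, ‖U n t x - u t x‖ ^ 2) atTop (𝓝 0) ∧
      Tendsto (fun n => Torus.gradNormSq (fun x => U n t x - u t x)) atTop (𝓝 0)) :
    ∃ (u' : ℝ → UnitAddTorus d → EuclideanSpace ℝ d) (p' : ℝ → UnitAddTorus d → ℝ),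
      Torus.IsClassicalNSSolutionOn (Icc 0 (b + T / 2)) ν (fun _ => F) u' p' ∧ u' 0 = u 0 ∧
      (∀ t ∈ Icc 0 (b + T / 2), Torus.HasZeroMean (u' t)) ∧
      ∀ t ∈ Icc 0 (b + T / 2), Tendsto (fun n => ∫ x, ‖U n t x - u' t x‖ ^ 2) atTop (𝓝 0) ∧
        Tendsto (fun n => Torus.gradNormSq (fun x => U n t x - u' t x)) atTop (𝓝 0) := by
  -- the restart time `s = b - T/2`
  set s : ℝ := b - T / 2 with hs_def
  have hs0 : 0 ≤ s := by rw [hs_def]; linarith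
  have hsb : s < b := by rw [hs_def]; linarith
  have hsT : s + T = b + T / 2 := by rw [hs_def]; ring
  have hsmem : s ∈ Icc 0 b := ⟨hs0, hsb.le⟩
  -- the restart datum `u s` has enstrophy `≤ R`
  have hus : Torus.IsSmooth (u s) := hu.smooth_velocity.isSmooth_slice hsmem
  have husR : Torus.gradNormSq (u s) ≤ R :=
    Torus.gradNormSq_le_of_tendsto_gradNormSq_sub
      (fun n => (hU n).smooth_velocity.isSmooth_slice (mem_Ici.2 hs0)) hus (fun n => hUR n s hs0)
      (hconv s hsmem).2
  obtain ⟨v, q, hv, hv0, hvmean⟩ := hE6 (u s) hus (hu.divFree s hsmem) (humean s hsmem) husR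
  -- translate the restarted piece to `[s, s + T]`, identify on `[s, b]` and glue
  have hv' : Torus.IsClassicalNSSolutionOn (Icc s (s + T)) ν (fun _ => F) (fun t => v (t - s))
      (fun t => q (t - s)) :=
    (hv.comp_sub_const s).mono (fun t ht => by
      simp only [mem_preimage, mem_Icc] at ht ⊢
      constructor <;> linarith [ht.1, ht.2]) (uniqueDiffOn_Icc (by linarith))
  have h0' : (fun t => v (t - s)) s = u s := by simp only [sub_self, hv0]
  obtain ⟨u', p', hsol, hleft, hcases⟩ := hu.glue_restart hν.le hv' hs0 hsb (by linarith) h0'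
  rw [hsT] at hsol hcases
  have hmean' : ∀ t ∈ Icc 0 (b + T / 2), Torus.HasZeroMean (u' t) := by
    intro t ht
    rcases hcases t ht with ⟨ht₁, hte⟩ | ⟨ht₂, hte⟩
    · rw [hte]
      exact humean t ht₁
    · rw [hte]
      exact hvmean (t - s) ⟨by linarith [ht₂.1], by linarith [ht₂.2]⟩
  have hseam : u' s = u s := hleft s ⟨hs0, le_rfl⟩
  -- convergence on the new window `[s, s + T]`
  have hwin := Torus.classicalNS_tendsto_h1_of_tendsto_h1_left hd hν hT (a := s) (R := R)
    (fun n => (hU n).mono (fun τ hτ => mem_Ici.2 (hs0.trans hτ.1)) (uniqueDiffOn_Icc (by linarith)))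
    (fun n τ hτ => hUmean n τ (hs0.trans hτ.1)) (fun n τ hτ => hUR n τ (hs0.trans hτ.1))
    (hsol.mono (fun τ hτ => ⟨hs0.trans hτ.1, by linarith [hτ.2]⟩) (uniqueDiffOn_Icc (by linarith)))
    (fun τ hτ => hmean' τ ⟨hs0.trans hτ.1, by linarith [hτ.2]⟩)
    (by simp only [hseam]; exact (hconv s hsmem).1) (by simp only [hseam]; exact (hconv s hsmem).2)
  refine ⟨u', p', hsol, hleft 0 ⟨le_rfl, hs0⟩, hmean', fun t ht => ?_⟩
  by_cases hts : t ≤ s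
  · have hte : u' t = u t := hleft t ⟨ht.1, hts⟩
    simp only [hte]
    exact hconv t ⟨ht.1, hts.trans hsb.le⟩
  · exact hwin t ⟨(not_le.1 hts).le, by linarith [ht.2]⟩

/-- **Limits of global bounded-enstrophy classical solutions are global classical solutions**
(Robinson–Rodrigo–Sadowski 2016, Thm 6.10 / §8.1: continuous dependence in `V` iterated along the
restart construction). On `T^d`, `card d = 3`, for `ν > 0` and a steady force `F`, let `(Uₙ, Pₙ)` be
classical solutions of NS_ν(F) on `[0, ∞) × T^d` with mean-zero slices and `‖∇Uₙ(t)‖₂² ≤ R` for all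
`t ≥ 0`, and let `w` be smooth, divergence free and mean zero with `∫ ‖Uₙ(0) − w‖² → 0` and
`‖∇(Uₙ(0) − w)‖₂² → 0`. Then there is a classical solution `(u, p)` of NS_ν(F) on `[0, ∞) × T^d` with
`u(0) = w`, mean-zero slices and `Uₙ(t) → u(t)` in `H¹` (both `∫ ‖Uₙ(t) − u(t)‖² → 0` and
`‖∇(Uₙ(t) − u(t))‖₂² → 0`) for every `t ≥ 0`. Proof: `T = T(R)` from E6 around the background `U₀` on
`[0, 1]`; base `[0, T]` from the datum `w` (`‖∇w‖₂² ≤ R` in the limit) and the window lemma; the step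
`Torus.classicalNS_globalLimit_step` `⌈·⌉` times; `exists_of_forall_nat`.
[cite: RobinsonRodrigoSadowskiCUP2016, Thm 6.10 with §8.1] -/
theorem Torus.exists_global_classicalNS_of_tendsto (hd : Fintype.card d = 3) (hν : 0 < ν)
    (hU : ∀ n, Torus.IsClassicalNSSolutionOn (Ici 0) ν (fun _ => F) (U n) (P n))
    (hUmean : ∀ n, ∀ t : ℝ, 0 ≤ t → Torus.HasZeroMean (U n t))
    (hUR : ∀ n, ∀ t : ℝ, 0 ≤ t → Torus.gradNormSq (U n t) ≤ R)
    (hw : Torus.IsSmooth w) (hwdiv : Torus.IsDivFree w) (hwmean : Torus.HasZeroMean w)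
    (h0 : Tendsto (fun n => ∫ x, ‖U n 0 x - w x‖ ^ 2) atTop (𝓝 0))
    (h1 : Tendsto (fun n => Torus.gradNormSq (fun x => U n 0 x - w x)) atTop (𝓝 0)) :
    ∃ (u : ℝ → UnitAddTorus d → EuclideanSpace ℝ d) (p : ℝ → UnitAddTorus d → ℝ),
      Torus.IsClassicalNSSolutionOn (Ici 0) ν (fun _ => F) u p ∧ u 0 = w ∧
      (∀ t : ℝ, 0 ≤ t → Torus.HasZeroMean (u t)) ∧
      ∀ t : ℝ, 0 ≤ t → Tendsto (fun n => ∫ x, ‖U n t x - u t x‖ ^ 2) atTop (𝓝 0) ∧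
        Tendsto (fun n => Torus.gradNormSq (fun x => U n t x - u t x)) atTop (𝓝 0) := by
  -- the forced continuation theorem around the background `U 0` on `[0, 1]`, level `R`
  have hbg : Torus.IsClassicalNSSolutionOn (Icc 0 1) ν (fun _ => F) (U 0) (P 0) :=
    (hU 0).mono (fun t ht => mem_Ici.2 ht.1) (uniqueDiffOn_Icc one_pos)
  obtain ⟨T, hT, -, hE6⟩ := hbg.exists_forced_solution_of_gradNormSq_le hd hν one_pos
    (fun t ht => hUmean 0 t ht.1) R
  have hE6' : ∀ u₀ : UnitAddTorus d → EuclideanSpace ℝ d, Torus.IsSmooth u₀ → Torus.IsDivFree u₀ →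
      Torus.HasZeroMean u₀ → Torus.gradNormSq u₀ ≤ R →
      ∃ (v : ℝ → UnitAddTorus d → EuclideanSpace ℝ d) (q : ℝ → UnitAddTorus d → ℝ),
        Torus.IsClassicalNSSolutionOn (Icc 0 T) ν (fun _ => F) v q ∧ v 0 = u₀ ∧
          ∀ t ∈ Icc 0 T, Torus.HasZeroMean (v t) := fun u₀ h₁ h₂ h₃ h₄ => by
    obtain ⟨v, q, hv, hv0, hvm, -⟩ := hE6 u₀ h₁ h₂ h₃ h₄
    exact ⟨v, q, hv, hv0, hvm⟩
  -- base: the solution through `w` on `[0, T]`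
  have hwR : Torus.gradNormSq w ≤ R :=
    Torus.gradNormSq_le_of_tendsto_gradNormSq_sub
      (fun n => (hU n).smooth_velocity.isSmooth_slice (mem_Ici.2 le_rfl)) hw (fun n => hUR n 0 le_rfl) h1
  obtain ⟨u₀, p₀, hu₀, hu₀0, hu₀mean⟩ := hE6' w hw hwdiv hwmean hwR
  have hconv₀ : ∀ t ∈ Icc 0 (0 + T), Tendsto (fun n => ∫ x, ‖U n t x - u₀ t x‖ ^ 2) atTop (𝓝 0) ∧
      Tendsto (fun n => Torus.gradNormSq (fun x => U n t x - u₀ t x)) atTop (𝓝 0) := by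
    have hu₀' : Torus.IsClassicalNSSolutionOn (Icc 0 (0 + T)) ν (fun _ => F) u₀ p₀ := by
      rw [zero_add]; exact hu₀
    refine Torus.classicalNS_tendsto_h1_of_tendsto_h1_left hd hν hT (a := 0) (R := R)
      (fun n => (hU n).mono (fun τ hτ => mem_Ici.2 hτ.1) (uniqueDiffOn_Icc (by linarith)))
      (fun n τ hτ => hUmean n τ hτ.1) (fun n τ hτ => hUR n τ hτ.1) hu₀'
      (fun τ hτ => hu₀mean τ (by rw [zero_add] at hτ; exact hτ)) ?_ ?_
    · simp only [hu₀0]; exact h0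
    · simp only [hu₀0]; exact h1
  -- induction: solutions through `w` on `[0, T + m T/2]`
  have hInv : ∀ m : ℕ, ∃ (u : ℝ → UnitAddTorus d → EuclideanSpace ℝ d) (p : ℝ → UnitAddTorus d → ℝ),
      Torus.IsClassicalNSSolutionOn (Icc 0 (T + m * (T / 2))) ν (fun _ => F) u p ∧ u 0 = w ∧
      (∀ t ∈ Icc 0 (T + m * (T / 2)), Torus.HasZeroMean (u t)) ∧
      ∀ t ∈ Icc 0 (T + m * (T / 2)), Tendsto (fun n => ∫ x, ‖U n t x - u t x‖ ^ 2) atTop (𝓝 0) ∧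
        Tendsto (fun n => Torus.gradNormSq (fun x => U n t x - u t x)) atTop (𝓝 0) := by
    intro m
    induction m with
    | zero =>
      refine ⟨u₀, p₀, ?_, hu₀0, ?_, ?_⟩
      · simp only [Nat.cast_zero, zero_mul, add_zero]; exact hu₀
      · simp only [Nat.cast_zero, zero_mul, add_zero]; exact hu₀mean
      · simp only [Nat.cast_zero, zero_mul, add_zero]
        intro t ht
        exact hconv₀ t (by rw [zero_add]; exact ht)
    | succ m ih =>
      obtain ⟨u, p, hu, hu0, hum, hconv⟩ := ih
      have hTb : T ≤ T + m * (T / 2) := le_add_of_nonneg_right (by positivity)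
      obtain ⟨u', p', hu', hu'0, hum', hconv'⟩ :=
        Torus.classicalNS_globalLimit_step hd hν hT hU hUmean hUR hE6' hTb hu hum hconv
      have heq : T + m * (T / 2) + T / 2 = T + ((m + 1 : ℕ) : ℝ) * (T / 2) := by push_cast; ring
      rw [heq] at hu' hum' hconv'
      exact ⟨u', p', hu', hu'0.trans hu0, hum', hconv'⟩
  -- assemble on `[0, ∞)`
  choose u p hu hu0 hum hconv using hInv
  have htop : Tendsto (fun m : ℕ => T + m * (T / 2)) atTop atTop :=
    tendsto_atTop_add_const_left _ _ (tendsto_natCast_atTop_atTop.atTop_mul_const (half_pos hT))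
  obtain ⟨Ug, Pg, hUg, hUgeq⟩ := Torus.IsClassicalNSSolutionOn.exists_of_forall_nat hν.le htop hu
    (fun m => by rw [hu0 m, hu0 0])
  have hex : ∀ t : ℝ, ∃ m : ℕ, t ≤ T + m * (T / 2) := fun t =>
    (htop.eventually (eventually_ge_atTop t)).exists
  refine ⟨Ug, Pg, hUg, ?_, fun t ht => ?_, fun t ht => ?_⟩
  · have h00 : (0 : ℝ) ∈ Icc 0 (T + (0 : ℕ) * (T / 2)) := ⟨le_rfl, by simp [hT.le]⟩
    rw [hUgeq 0 0 h00, hu0 0]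
  · obtain ⟨m, hm⟩ := hex t
    rw [hUgeq m t ⟨ht, hm⟩]
    exact hum m t ⟨ht, hm⟩
  · obtain ⟨m, hm⟩ := hex t
    simp only [hUgeq m t ⟨ht, hm⟩]
    exact hconv m t ⟨ht, hm⟩

/-- **The bounds pass to the global limit.** Under the hypotheses of
`Torus.exists_global_classicalNS_of_tendsto`, if moreover the `Uₙ(t)` obey a uniform bound
`∑_{k ∈ S} a_k ‖Ûₙ(t)(k)‖² ≤ C` on weighted finite sums of squared Fourier coefficients (all `n`, all
`t ≥ 0`, all finite `S`; e.g. a uniform Gevrey bound), then the global limit solution `(u, p)` satisfies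
`‖∇u(t)‖₂² ≤ R` and `∑_{k ∈ S} a_k ‖û(t)(k)‖² ≤ C` for all `t ≥ 0` besides `u(0) = w`, mean-zero slices and
the `H¹`-convergence `Uₙ(t) → u(t)` (`gradNormSq_le_of_tendsto_gradNormSq_sub`,
`sum_mul_norm_sq_mFourierCoeff_le_of_tendsto`). [cite: RobinsonRodrigoSadowskiCUP2016, Thm 6.10 with §8.1] -/
theorem Torus.exists_global_classicalNS_of_tendsto_of_bounds (hd : Fintype.card d = 3) (hν : 0 < ν)
    (hU : ∀ n, Torus.IsClassicalNSSolutionOn (Ici 0) ν (fun _ => F) (U n) (P n))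
    (hUmean : ∀ n, ∀ t : ℝ, 0 ≤ t → Torus.HasZeroMean (U n t))
    (hUR : ∀ n, ∀ t : ℝ, 0 ≤ t → Torus.gradNormSq (U n t) ≤ R)
    (a : (d → ℤ) → ℝ) {C : ℝ}
    (hUC : ∀ n, ∀ t : ℝ, 0 ≤ t → ∀ S : Finset (d → ℤ),
      ∑ k ∈ S, a k * ‖mFourierCoeff (EuclideanSpace.complexify ∘ U n t) k‖ ^ 2 ≤ C)
    (hw : Torus.IsSmooth w) (hwdiv : Torus.IsDivFree w) (hwmean : Torus.HasZeroMean w)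
    (h0 : Tendsto (fun n => ∫ x, ‖U n 0 x - w x‖ ^ 2) atTop (𝓝 0))
    (h1 : Tendsto (fun n => Torus.gradNormSq (fun x => U n 0 x - w x)) atTop (𝓝 0)) :
    ∃ (u : ℝ → UnitAddTorus d → EuclideanSpace ℝ d) (p : ℝ → UnitAddTorus d → ℝ),
      Torus.IsClassicalNSSolutionOn (Ici 0) ν (fun _ => F) u p ∧ u 0 = w ∧
      (∀ t : ℝ, 0 ≤ t → Torus.HasZeroMean (u t)) ∧ (∀ t : ℝ, 0 ≤ t → Torus.gradNormSq (u t) ≤ R) ∧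
      (∀ t : ℝ, 0 ≤ t → ∀ S : Finset (d → ℤ),
        ∑ k ∈ S, a k * ‖mFourierCoeff (EuclideanSpace.complexify ∘ u t) k‖ ^ 2 ≤ C) ∧
      ∀ t : ℝ, 0 ≤ t → Tendsto (fun n => ∫ x, ‖U n t x - u t x‖ ^ 2) atTop (𝓝 0) ∧
        Tendsto (fun n => Torus.gradNormSq (fun x => U n t x - u t x)) atTop (𝓝 0) := by
  obtain ⟨u, p, hu, hu0, hum, hconv⟩ :=
    Torus.exists_global_classicalNS_of_tendsto hd hν hU hUmean hUR hw hwdiv hwmean h0 h1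
  have hUs : ∀ n t, 0 ≤ t → Torus.IsSmooth (U n t) := fun n t ht =>
    (hU n).smooth_velocity.isSmooth_slice (mem_Ici.2 ht)
  have hus : ∀ t, 0 ≤ t → Torus.IsSmooth (u t) := fun t ht => hu.smooth_velocity.isSmooth_slice (mem_Ici.2 ht)
  refine ⟨u, p, hu, hu0, hum, fun t ht => ?_, fun t ht S => ?_, hconv⟩
  · exact Torus.gradNormSq_le_of_tendsto_gradNormSq_sub (fun n => hUs n t ht) (hus t ht)
      (fun n => hUR n t ht) (hconv t ht).2
  · exact Torus.sum_mul_norm_sq_mFourierCoeff_le_of_tendsto (fun n => (hUs n t ht).continuous)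
      (hus t ht).continuous (hconv t ht).1 a S (fun n => hUC n t ht S)

end GlobalLimit

end Literature.Analysis.FluidPDE

end
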